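import Summits.ABC.IUTFork.Repair.RHHeightScaling
import Summits.ABC.IUTFork.Repair.RHHeightScalingPartialCredit
import Mathlib.Analysis.SpecialFunctions.Pow.Asymptotics
import HarnessLib

/-!
# R-H round-3 AXIS D2 · D2-EXP-4 — the «PARTIAL CREDIT» profile in the shared D2 vocabulary: `PriceBounded`, `ExponentAtMost (−1)`,
# `¬ DoorAt`, and EXACTNESS (no exponent below `−1`) (PROOF-ONLY, 0 defs)

abc-iut cell, rung LADDER-ABC:A2.RESCUE.H, round-3 axis D2; seat abc-iut-rh2-q3-num g4 (KEY D2-EXP-4). Companion of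
`Repair/RHHeightScalingPartialCredit.lean` (the sandwich (L1)/(L2) over an abstract finite cell family) read through rh2-T-1's shared vocabulary
`Repair/RHHeightScaling.lean` (`ExponentAtMost`, `NegExponent`, `DoorAt`, `PriceBounded`). The class profile is
  `f(s) = PCmass(s) / (s·Στ)`, `PCmass(s) = Σ_{c : p s c < s·τ c} p s c`
(cells `c` with demand slope `τ c ≥ 0`, price `p s c` at dilation `s` inside a height-free band `a c ≤ p s c ≤ b c`, weightless cells priced `≥ 0`).
* `priceBounded_partialCredit` — the profile is `PriceBounded (Στ)` with the ∀-kind constant `Σ_{τ>0} b` (R81 (G1): an `ExponentAtMost` instance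
  cites only a constant certified for every `s ≥ 1` — here (L1) of the companion file);
* `exponentAtMost_partialCredit` — `ExponentAtMost f (−1) (Σ_{τ>0} b / Στ)`; `negExponent_partialCredit`; `not_doorAt_partialCredit` — NO DOOR in
  the class;
* `not_exponentAtMost_of_lt_neg_one` — EXACTNESS: if the last licence is passed at some `s₀ ≥ 1` and `Σ_{τ>0} a > 0`, then for every `α < −1`
  and every constant `C`, `ExponentAtMost f α C` FAILS (the profile is `≥ (Σ_{τ>0} a/Στ)/s` from `s₀` on, (L2)) — the exponent is `−1`, not lower.
HONEST FRAMING: elementary real analysis about a finite table of numbers; the reading «table ↔ genuine datum» is the kit certificate (computed ≠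
proved); nothing here asserts that abc is proved or refuted, or that [IUTchIII] Cor. 3.12 / [IUTchIV] Thm. 1.10 holds or fails at any datum, or takes
a side on any author; typed ≠ proved. [folklore] throughout.
-/

namespace Summit.ABC.IUTFork.Repair.RH.HeightScaling.PartialCredit

open Finset Filter Topology Summit.ABC.IUTFork.Repair.RH.HeightScaling

variable {ι : Type*} {cells : Finset ι} {τ a b : ι → ℝ} {p : ℝ → ι → ℝ}

/-- **The partial-credit profile is PRICE-BOUNDED** (certificate `PCmass(s)`, ∀-kind cap `Σ_{τ>0} b`, total `s·Στ`). [folklore] -/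
theorem priceBounded_partialCredit (hτ : ∀ c ∈ cells, 0 ≤ τ c) (hp0 : ∀ s : ℝ, 1 ≤ s → ∀ c ∈ cells, τ c = 0 → 0 ≤ p s c)
    (hb : ∀ s : ℝ, 1 ≤ s → ∀ c ∈ cells, p s c ≤ b c) :
    PriceBounded (∑ c ∈ cells, τ c)
      (fun s => (∑ c ∈ cells.filter (fun c => p s c < s * τ c), p s c) / (s * ∑ c ∈ cells, τ c)) :=
  ⟨fun s => ∑ c ∈ cells.filter (fun c => p s c < s * τ c), p s c, ∑ c ∈ cells.filter (fun c => 0 < τ c), b c,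
    fun s hs => partialCreditMass_le_sum_hi hτ (hp0 s hs) (hb s hs) (zero_le_one.trans hs), fun _ _ => rfl⟩

/-- **EXPONENT `−1` WITH THE ∀-KIND CONSTANT `A_hi = Σ_{τ>0} b / Στ`.** [folklore] -/
theorem exponentAtMost_partialCredit (hτ : ∀ c ∈ cells, 0 ≤ τ c) (hp0 : ∀ s : ℝ, 1 ≤ s → ∀ c ∈ cells, τ c = 0 → 0 ≤ p s c)
    (hb : ∀ s : ℝ, 1 ≤ s → ∀ c ∈ cells, p s c ≤ b c) (hM : 0 < ∑ c ∈ cells, τ c) :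
    ExponentAtMost (fun s => (∑ c ∈ cells.filter (fun c => p s c < s * τ c), p s c) / (s * ∑ c ∈ cells, τ c)) (-1)
      ((∑ c ∈ cells.filter (fun c => 0 < τ c), b c) / ∑ c ∈ cells, τ c) :=
  exponentAtMost_neg_one_of_le_const hM fun s hs =>
    partialCreditMass_le_sum_hi hτ (hp0 s hs) (hb s hs) (zero_le_one.trans hs)

/-- Hence a NEGATIVE exponent … [folklore] -/
theorem negExponent_partialCredit (hτ : ∀ c ∈ cells, 0 ≤ τ c) (hp0 : ∀ s : ℝ, 1 ≤ s → ∀ c ∈ cells, τ c = 0 → 0 ≤ p s c)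
    (hb : ∀ s : ℝ, 1 ≤ s → ∀ c ∈ cells, p s c ≤ b c) (hM : 0 < ∑ c ∈ cells, τ c) :
    NegExponent (fun s => (∑ c ∈ cells.filter (fun c => p s c < s * τ c), p s c) / (s * ∑ c ∈ cells, τ c)) :=
  negExponent_of_priceBounded hM (priceBounded_partialCredit hτ hp0 hb)

/-- … and **NO DOOR inside the class «partial credit»** (bed reading per R82 (e)/R84: on CONJUGATE-FIBRE data — all three beds, every `F_mod = ℚ`
datum — every admitted profile of the class is price-bounded, hence `¬ DoorAt`; the hypothesis, not the bed, carries the theorem). [folklore] -/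
theorem not_doorAt_partialCredit (hτ : ∀ c ∈ cells, 0 ≤ τ c) (hp0 : ∀ s : ℝ, 1 ≤ s → ∀ c ∈ cells, τ c = 0 → 0 ≤ p s c)
    (hb : ∀ s : ℝ, 1 ≤ s → ∀ c ∈ cells, p s c ≤ b c) (hM : 0 < ∑ c ∈ cells, τ c) :
    ¬ DoorAt (fun s => (∑ c ∈ cells.filter (fun c => p s c < s * τ c), p s c) / (s * ∑ c ∈ cells, τ c)) :=
  not_doorAt_of_negExponent (negExponent_partialCredit hτ hp0 hb hM)

/-- **EXACTNESS — the exponent is `−1`, not lower.** If the last licence is passed at some `s₀ ≥ 1` (`b c < s₀·τ c` at every weighted cell)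
and the lower prices of the weighted cells have positive total, then for every `α < −1` and every constant `C` the profile is NOT
`ExponentAtMost α C`: from `s₀` on it is at least `(Σ_{τ>0} a / Στ)/s` ((L2) of the companion file), which beats `C·s^α` for `s` large. [folklore] -/
theorem not_exponentAtMost_of_lt_neg_one (hτ : ∀ c ∈ cells, 0 ≤ τ c) (hp0 : ∀ s : ℝ, 1 ≤ s → ∀ c ∈ cells, τ c = 0 → 0 ≤ p s c)
    (ha : ∀ s : ℝ, 1 ≤ s → ∀ c ∈ cells, a c ≤ p s c) (hb : ∀ s : ℝ, 1 ≤ s → ∀ c ∈ cells, p s c ≤ b c)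
    {s₀ : ℝ} (hs₀ : 1 ≤ s₀) (hlast : ∀ c ∈ cells, 0 < τ c → b c < s₀ * τ c)
    (hA : 0 < ∑ c ∈ cells.filter (fun c => 0 < τ c), a c) (hM : 0 < ∑ c ∈ cells, τ c) {α C : ℝ} (hα : α < -1) :
    ¬ ExponentAtMost (fun s => (∑ c ∈ cells.filter (fun c => p s c < s * τ c), p s c) / (s * ∑ c ∈ cells, τ c)) α C := by
  intro hf
  set A : ℝ := (∑ c ∈ cells.filter (fun c => 0 < τ c), a c) / ∑ c ∈ cells, τ c with hAdef
  have hApos : 0 < A := div_pos hA hM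
  have h0 : Tendsto (fun x : ℝ => x ^ (-(-(α + 1)))) atTop (𝓝 0) := tendsto_rpow_neg_atTop (by linarith)
  simp only [neg_neg] at h0
  have h1 : Tendsto (fun x : ℝ => C * x ^ (α + 1)) atTop (𝓝 (C * 0)) := h0.const_mul C
  rw [mul_zero] at h1
  have h2 : ∀ᶠ x : ℝ in atTop, C * x ^ (α + 1) < A := h1.eventually (gt_mem_nhds hApos)
  obtain ⟨x, hxA, hxs⟩ := (h2.and (eventually_ge_atTop s₀)).exists
  have hx1 : 1 ≤ x := hs₀.trans hxs
  have hxpos : 0 < x := zero_lt_one.trans_le hx1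
  have hlo := lo_div_le_partialCredit (t := x) hτ (hp0 x hx1) (ha x hx1) (hb x hx1) (last_licence_mono hlast hxs) hxpos hM
  have hup := hf x hx1
  have : A / x ≤ C * x ^ α := hlo.trans hup
  rw [div_le_iff₀ hxpos, mul_assoc, ← Real.rpow_add_one hxpos.ne'] at this
  exact absurd this (not_le.mpr hxA)

end Summit.ABC.IUTFork.Repair.RH.HeightScaling.PartialCredit
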